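import Literature.NumberTheory.LFunctions.VinogradovKorobovInputs
import Literature.NumberTheory.LFunctions.LehmanCriticalLineBoundProofs
import HarnessLib

/-!
# Patel's sub-Weyl bound `|ζ(½ + it)| ≤ 307.098 |t|^{27/164}`: reductions and the range `|t| ≤ e⁵⁶`

Topic `Literature/NumberTheory/LFunctions`. `VinogradovKorobovInputs.lean` vendors as the NAMED
FACT `Literature.NumberTheory.LFunctions.zeta_half_line_patel` the input (3.3) of
Mossinghoff–Trudgian–Yang: for `|t| ≥ 3`, `|ζ(½ + it)| ≤ 307.098 |t|^{27/164}` (D. Patel, PhD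
thesis, Ohio State 2021, main theorem; Patel–Yang, *J. Number Theory* 262 (2024) =
arXiv:2302.13444, eq. (1.2), where it is sharpened to `66.7 t^{27/164}`, Theorem 1.1).

This file holds the first PROVED pieces of its discharge (everything here is proved, no named
facts):

* `Literature.NumberTheory.LFunctions.zeta_half_line_patel_of_forall_pos` — by `ζ(s̄) = conj ζ(s)` the
  fact follows from its restriction to `t ≥ 3` (the form printed in the sources);
* `Literature.NumberTheory.LFunctions.norm_zeta_half_le_patel_of_le_exp56` — **the range
  `3 ≤ t ≤ e⁵⁶`**: there Lehman's convexity-strength bound `|ζ(½ + it)| ≤ 2.53 t^{1/4}` (`t > 1`;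
  Trudgian 2011, Lemma 2.5 with its footnote, PROVED in the tree as
  `Literature.NumberTheory.LFunctions.Trudgian2011_lemma_2_5_allT_holds`, file
  `LehmanCriticalLineBoundProofs.lean`) is already smaller: `2.53 t^{1/4} ≤ 307.098 t^{27/164}` iff
  `t^{7/82} ≤ 307.098/2.53 = 121.38…`, i.e. `t ≤ e^{56.2…}`; we use `t⁷ ≤ (e⁵⁶)⁷ = (e¹⁹⁶)² < (68/25)³⁹² ≤ (121⁴¹)²`
  and `2.53 · 121 ≤ 307.098`;
* `Literature.NumberTheory.LFunctions.zeta_half_line_patel_of_highRange` — consequently the fact is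
  reduced to the range `t ≥ e⁵⁶`, where a genuinely sub-Weyl estimate is needed (Patel–Yang §3: the
  Riemann–Siegel main sum, already in the tree as
  `Literature.NumberTheory.LFunctions.SiegelIntegral.norm_riemannZeta_half_le_two_mul` and
  `…riemannAux_eq_sum_add_rsLineIntegral`, bounded by the van der Corput processes `ABA³B`).

## References

* D. Patel, *Explicit sub-Weyl bound for the Riemann zeta function*, PhD thesis, The Ohio State
  University, 2021, main theorem. [cite: Patel2021, main theorem]
* D. Patel, A. Yang, *An explicit sub-Weyl bound for `ζ(1/2 + it)`*, J. Number Theory 262 (2024),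
  301–334 = arXiv:2302.13444, eq. (1.2) and Theorem 1.1. [cite: PatelYang2024, (1.2)]
* M. J. Mossinghoff, T. S. Trudgian, A. Yang, *Explicit zero-free regions for the Riemann
  zeta-function*, Res. Number Theory 10 (2024) = arXiv:2212.06867, (3.3).
  [cite: MossinghoffTrudgianYangRNT2024, (3.3)]
* T. S. Trudgian, *Improvements to Turing's method*, Math. Comp. 80 (2011), Lemma 2.5 and
  footnote 3. [cite: Trudgian2011, Lemma 2.5]
-/

noncomputable section

open Complex Real
open scoped ComplexConjugate

namespace Literature.NumberTheory.LFunctions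

/-- **Reduction to `t ≥ 3`.** Patel's bound for `|t| ≥ 3` follows from the case `t ≥ 3` by the
conjugation symmetry `|ζ(½ − it)| = |ζ(½ + it)|`. [folklore] -/
theorem zeta_half_line_patel_of_forall_pos
    (h : ∀ t : ℝ, 3 ≤ t → ‖riemannZeta (1 / 2 + t * I)‖ ≤ 307.098 * t ^ (27 / 164 : ℝ)) :
    zeta_half_line_patel := by
  intro t ht
  rcases le_or_gt 0 t with h0 | h0
  · rw [abs_of_nonneg h0] at ht ⊢
    exact h t ht
  · have hneg : 3 ≤ -t := by rwa [abs_of_neg h0] at ht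
    have hconj : riemannZeta (1 / 2 + t * I) = conj (riemannZeta (1 / 2 + (-t : ℝ) * I)) := by
      rw [← riemannZeta_conj]; congr 1
      apply Complex.ext <;> simp
    rw [hconj, Complex.norm_conj, abs_of_neg h0]
    exact h (-t) hneg

/-- The numerical comparison behind the low range: `(68/25)¹⁹⁶ ≤ 121⁴¹`
(`196 log 2.72 = 196.1… < 196.6… = 41 log 121`). [folklore] -/
lemma pow_196_le_pow_41 : ((68 : ℝ) / 25) ^ 196 ≤ (121 : ℝ) ^ 41 := by
  rw [div_pow, div_le_iff₀ (by positivity)]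
  norm_num

/-- `e¹⁹⁶ ≤ 121⁴¹` (`e < 2.72 = 68/25`). [folklore] -/
lemma exp_196_le : Real.exp 196 ≤ (121 : ℝ) ^ 41 := by
  have h1 : Real.exp 1 < 68 / 25 := lt_trans Real.exp_one_lt_d9 (by norm_num)
  have h2 : Real.exp 196 = Real.exp 1 ^ 196 := by
    rw [Real.exp_one_pow 196]; norm_cast
  rw [h2]
  exact (pow_le_pow_left₀ (Real.exp_pos 1).le h1.le 196).trans pow_196_le_pow_41

/-- `e³⁹² ≤ 121⁸²`. [folklore] -/
lemma exp_392_le : Real.exp 392 ≤ (121 : ℝ) ^ 82 := by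
  have h1 : Real.exp 392 = Real.exp 196 ^ 2 := by
    rw [← Real.exp_nat_mul]; norm_num
  rw [h1, show (121 : ℝ) ^ 82 = ((121 : ℝ) ^ 41) ^ 2 by rw [← pow_mul]]
  exact pow_le_pow_left₀ (Real.exp_pos _).le exp_196_le 2

/-- For `0 ≤ t ≤ e⁵⁶`: `t^{7/82} ≤ 121`. [folklore] -/
lemma rpow_seven_div_82_le {t : ℝ} (h0 : 0 ≤ t) (h56 : t ≤ Real.exp 56) :
    t ^ (7 / 82 : ℝ) ≤ 121 := by
  have h7 : t ^ 7 ≤ (121 : ℝ) ^ 82 := by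
    calc t ^ 7 ≤ Real.exp 56 ^ 7 := pow_le_pow_left₀ h0 h56 7
      _ = Real.exp 392 := by rw [← Real.exp_nat_mul]; norm_num
      _ ≤ 121 ^ 82 := exp_392_le
  have e1 : t ^ (7 / 82 : ℝ) = (t ^ 7) ^ ((82 : ℕ)⁻¹ : ℝ) := by
    rw [← Real.rpow_natCast t 7, ← Real.rpow_mul h0]
    norm_num
  have e2 : (121 : ℝ) = ((121 : ℝ) ^ 82) ^ ((82 : ℕ)⁻¹ : ℝ) :=
    (Real.pow_rpow_inv_natCast (by norm_num) (by norm_num)).symm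
  rw [e1, e2]
  exact Real.rpow_le_rpow (by positivity) h7 (by positivity)

/-- **Patel's bound in the low range `3 ≤ t ≤ e⁵⁶`**, from Lehman's `|ζ(½ + it)| ≤ 2.53 t^{1/4}`
(Trudgian 2011, Lemma 2.5 and footnote, proved in the tree): `2.53 t^{1/4} = 2.53 t^{7/82} t^{27/164}
≤ 2.53 · 121 · t^{27/164} ≤ 307.098 t^{27/164}`.
[cite: Patel2021, main theorem] [cite: Trudgian2011, Lemma 2.5] -/
theorem norm_zeta_half_le_patel_of_le_exp56 {t : ℝ} (h3 : 3 ≤ t) (h56 : t ≤ Real.exp 56) :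
    ‖riemannZeta (1 / 2 + t * I)‖ ≤ 307.098 * t ^ (27 / 164 : ℝ) := by
  have h0 : 0 ≤ t := by linarith
  have hL : ‖riemannZeta (1 / 2 + t * I)‖ ≤ 2.53 * t ^ (1 / 4 : ℝ) :=
    Trudgian2011_lemma_2_5_allT_holds t (by linarith)
  have hsplit : t ^ (1 / 4 : ℝ) = t ^ (7 / 82 : ℝ) * t ^ (27 / 164 : ℝ) := by
    rw [← Real.rpow_add' h0 (by norm_num)]
    norm_num
  have hsmall := rpow_seven_div_82_le h0 h56
  have hpos : 0 ≤ t ^ (27 / 164 : ℝ) := Real.rpow_nonneg h0 _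
  calc ‖riemannZeta (1 / 2 + t * I)‖ ≤ 2.53 * t ^ (1 / 4 : ℝ) := hL
    _ = 2.53 * t ^ (7 / 82 : ℝ) * t ^ (27 / 164 : ℝ) := by rw [hsplit, mul_assoc]
    _ ≤ 2.53 * 121 * t ^ (27 / 164 : ℝ) := by gcongr
    _ ≤ 307.098 * t ^ (27 / 164 : ℝ) := by nlinarith

/-- The same on `3 ≤ |t| ≤ e⁵⁶`, in the two-sided form of the named fact. [cite: Patel2021, main theorem] -/
theorem norm_zeta_half_le_patel_of_abs_le_exp56 {t : ℝ} (h3 : 3 ≤ |t|) (h56 : |t| ≤ Real.exp 56) :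
    ‖riemannZeta (1 / 2 + t * I)‖ ≤ 307.098 * |t| ^ (27 / 164 : ℝ) := by
  rcases le_or_gt 0 t with h0 | h0
  · rw [abs_of_nonneg h0] at h3 h56 ⊢
    exact norm_zeta_half_le_patel_of_le_exp56 h3 h56
  · rw [abs_of_neg h0] at h3 h56 ⊢
    have hconj : riemannZeta (1 / 2 + t * I) = conj (riemannZeta (1 / 2 + (-t : ℝ) * I)) := by
      rw [← riemannZeta_conj]; congr 1
      apply Complex.ext <;> simp
    rw [hconj, Complex.norm_conj]
    exact norm_zeta_half_le_patel_of_le_exp56 h3 h56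

/-- **What remains of Patel's fact**: it follows from the sub-Weyl range `t ≥ e⁵⁶` alone (the range
`3 ≤ t ≤ e⁵⁶` being covered by Lehman's bound, and `t ≤ -3` by conjugation).
[cite: Patel2021, main theorem] [cite: PatelYang2024, §3] -/
theorem zeta_half_line_patel_of_highRange
    (h : ∀ t : ℝ, Real.exp 56 ≤ t → ‖riemannZeta (1 / 2 + t * I)‖ ≤ 307.098 * t ^ (27 / 164 : ℝ)) :
    zeta_half_line_patel := by
  refine zeta_half_line_patel_of_forall_pos fun t ht ↦ ?_
  rcases le_or_gt t (Real.exp 56) with h56 | h56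
  · exact norm_zeta_half_le_patel_of_le_exp56 ht h56
  · exact h t h56.le

end Literature.NumberTheory.LFunctions
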